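import Summits.CriticalPhenomena.PercolationContinuityZ3.Theorems.PercNearOneGluingNoHeavyLowerTailQuantitativeS5PeelIdentity
import Summits.CriticalPhenomena.PercolationContinuityZ3.Theorems.PercNearOneGluingNoHeavyLowerTailQuantitativeS5FloorBricks
import Summits.CriticalPhenomena.PercolationContinuityZ3.Theorems.PercNearOneGluingNoHeavyLowerTailQuantitativeCshGateLocus
import HarnessLib

/-!
# THE GATES-FIRST MECHANISM: the explicit (S5) floor detects a positive margin at a rank placing the pocket's gates first

Support file (`--supports stmt-CriticalPhenomena-4575`), prover seat `prim-rate-mine-2` (lane prim-rate, constants-miner (c), BENCH row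
M2-R41; `run/shared/lean/prim/prim-rate/prim-rate-mine-2/PROOFS.md` §P41).  No definitions, no named facts, no sorries; standard axioms.

Weights non-degenerate on their support `E`; observers `o ≠ v`; a vertex set `K ∋ o` (the observer's pocket), `v ∉ K`, internally connected
from `o`, whose `E`-exits end at `v` or in a finite set `X` of GATES, each `E`-adjacent to `K`.  Relays `T` off `K`, decoys `D` off `K ∪ T`,
`F` monotone nonnegative, `r` injective on `T` and compatible with the means of `F`, and GATES FIRST: every relay outside `X` is ranked
above every gate, all gates being relays as long as a non-gate relay remains.  The floor is the general-decoy-list left side of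
`CSH.s5dMargin_ge_sum_rankGain_add_worldFloor_of_lt_one` with the world floor replaced by its isolated Harris minorant
(`Σ_a γ_a(r)·q_a + ∏_{e ∩ T_{<a} ≠ ∅}(1 − w_e)·Cov_{w_{T_{<a}}}(F(V 𝒞_a), 1{o ↔ {a} ∪ T_{>a} ∪ D ∨ o ↔ v})`; for `D = []` it is VERBATIM
the floor of `CSH.s5dMargin_ge_sum_rankGain_add_isolatedFloor_of_lt_one_of_compat`, rows M2-R21 / M2-R30).

* `CSH.floor_pos_of_gatesFirst` — **`0 < s5dMargin w T r D o v F` ⟹ the floor is positive at `r`.**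

Induction peeling the rank-maximal relay `k` through the exact identity
`μ(A_k)·M(T; D) = μ(A_k)·M(T ∖ k; k :: D) + cshMargin w k (T ∖ k) D o v F̂_k + γ_k·μ(A_k)·Marg[c_k]`
(`CSH.surplus_erase_add`, `CSH.covD_clusterFun_eq`, `CSH.rankGain_top_eq`); the floor splits accordingly (`CSH.rankGain_erase_top`).  A NON-GATE
`k` is peeled while all gates are still relays: `Marg[c_k] = 0` (pocket factorisation with the exit SET of gates, `CSH.avoid_ratio_of_pocket`)
and its level does not see its decoys (`CSH.cshMargin_eq_nil_of_decoys_off_pocket`), so a positive level has a pair pivotal for `F(V 𝒞_k)` and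
`{o ↔ k} ∪ {o ↔ v}` (`CSH.cshMargin_nil_pos_iff_exists_pivotal_vertexFun`), which is pivotal for the floor's event as well
(`CSH.exists_exit_of_walk_set`: an open path out of `K` ends at `v` or at a gate, and pairs into gates meet `T ∖ k`).  A GATE `k`: a positive
rank-gain term has `γ_k > 0` and `q_k > 0` (`CSH.avoidConst_pos_of_pocket_adj`); a positive level forces the gate pair to be `F`-pivotal
(`CSH.cshMargin_eq_zero_of_gate_not_pivotal`), and the gate pair is pivotal for the floor's event (a path inside `K`).  In every case the
`k`-summand of the floor is positive (`CSH.floor_iso_pos_of_pivotal`, the equality case of Harris `QuantHarris.cov_pos_iff_exists_influence`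
for the zeroed weights).  The assembly of row M2-R30 ⟹ at every compatible rank is `…QuantitativeS5FloorCompleteGeneral`.
[cite: KozmaNitzan2024, Conj. 4 (p. 32)] [cite: Harris1960, Lemma 4.1 (p. 16)] [cite: VandenbergHaggstromKahn2005, §2.1 (pp. 9–13)]
-/

noncomputable section

namespace Summit.CriticalPhenomena.PercolationContinuityZ3.Theorems

open MeasureTheory Set Literature.Probability.LatticeModels Literature.Probability.Percolation
open scoped Classical
open KNPreFKG

namespace CSH

variable {n : ℕ}

/-- **THE GATES-FIRST MECHANISM.**  Weights non-degenerate on their support `E`; `o ≠ v`; a vertex set `K ∋ o`, `v ∉ K`, internally connected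
from `o`, whose `E`-exits end at `v` or in the finite set `X`, every vertex of `X` being `E`-adjacent to `K`.  For every relay set `T` off
`K ∪ {o, v}`, every decoy list `D` (no repetitions) off `K ∪ T ∪ {o, v}`, every monotone nonnegative `F`, and every injective rank `r` on `T`
compatible with the means of `F` such that every relay outside `X` is ranked above every vertex of `X`, all of which are then relays:
`0 < s5dMargin w T r D o v F` ⟹ the explicit floor (general decoy list) is positive at `r`.
[cite: KozmaNitzan2024, Conj. 4 (p. 32)] [cite: Harris1960, Lemma 4.1 (p. 16)] -/
theorem floor_pos_of_gatesFirst (w : Sym2 (Fin n) → unitInterval) (E : Set (Sym2 (Fin n)))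
    (hE0 : ∀ f, f ∉ E → (w f : ℝ) = 0) (hE1 : ∀ f ∈ E, 0 < (w f : ℝ) ∧ (w f : ℝ) < 1) (o v : Fin n) (hov : o ≠ v)
    (K : Set (Fin n)) (hoK : o ∈ K) (hvK : v ∉ K) (hKconn : ∀ y ∈ K, (openGraph {f | f ∈ E ∧ ∀ z ∈ f, z ∈ K}).Reachable o y)
    (X : Finset (Fin n)) (hKexit : ∀ p q : Fin n, s(p, q) ∈ E → p ∈ K → q ∈ K ∨ q = v ∨ q ∈ (↑X : Set (Fin n)))
    (hXadj : ∀ g ∈ X, ∃ y ∈ K, s(y, g) ∈ E) :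
    ∀ (T : Finset (Fin n)) (r : Fin n → ℕ) (D : List (Fin n)) (F : Set (Fin n) → ℝ),
      Set.InjOn r ↑T → o ∉ T → v ∉ T → (∀ t ∈ T, t ∉ K) → D.Nodup → (∀ d ∈ D, d ∉ T ∧ d ≠ o ∧ d ≠ v) → (∀ d ∈ D, d ∉ K) →
      (∀ S S' : Set (Fin n), S ⊆ S' → F S ≤ F S') → (∀ S : Set (Fin n), 0 ≤ F S) →
      (∀ a ∈ T, ∀ a' ∈ T, r a < r a' → ∫ ω, F (openCluster ω a) ∂(prodBernoulli w) ≤ ∫ ω, F (openCluster ω a') ∂(prodBernoulli w)) →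
      (∀ t ∈ T, t ∉ X → ∀ g ∈ X, g ∈ T ∧ r g < r t) →
      0 < s5dMargin w T r D o v F →
      0 < ∑ a ∈ T, (rankGain w T r F a * avoidConst w a ((↑(T.erase a) : Set (Fin n)) ∪ ({d | d ∈ D} ∪ {v})) o +
        (∏ e ∈ Finset.univ.filter (fun e : Sym2 (Fin n) => ∃ y ∈ (↑(T.filter (fun b => r b < r a)) : Set (Fin n)), y ∈ e), (1 - (w e : ℝ))) *
          ((∫ η in ((⋃ t ∈ (insert a (T.filter (fun b => r a < r b) ∪ (D).toFinset)), openConn o t) ∪ openConn o v),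
              F {c | c = a ∨ ∃ e ∈ openEdgeCluster η a, c ∈ e}
              ∂(prodBernoulli fun e => if (∃ y ∈ (↑(T.filter (fun b => r b < r a)) : Set (Fin n)), y ∈ e) then (0 : unitInterval) else w e)) -
            (prodBernoulli fun e => if (∃ y ∈ (↑(T.filter (fun b => r b < r a)) : Set (Fin n)), y ∈ e) then (0 : unitInterval) else w e).real
                ((⋃ t ∈ (insert a (T.filter (fun b => r a < r b) ∪ (D).toFinset)), openConn o t) ∪ openConn o v) *
              (∫ η, F {c | c = a ∨ ∃ e ∈ openEdgeCluster η a, c ∈ e}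
                ∂(prodBernoulli fun e => if (∃ y ∈ (↑(T.filter (fun b => r b < r a)) : Set (Fin n)), y ∈ e) then (0 : unitInterval) else w e)))) := by
  have hw1r : ∀ e, (w e : ℝ) < 1 := by
    intro e
    by_cases he : e ∈ E
    · exact (hE1 e he).2
    · rw [hE0 e he]; norm_num
  have hw : ∀ e, w e < 1 := fun e => by
    have h := hw1r e
    exact Subtype.coe_lt_coe.1 (by simpa using h)
  -- strong induction on `|T|`
  intro T r D F hr hoT hvT hTK hD hDT hDK hF hF0 hcompat hinv hpos
  obtain ⟨N, hN⟩ : ∃ N, T.card = N := ⟨_, rfl⟩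
  induction N using Nat.strong_induction_on generalizing T r D F with
  | _ N ih =>
    set μ := prodBernoulli w with hμ
    have hmeas : ∀ S : Set (BondConfig (Fin n)), MeasurableSet S := fun _ => MeasurableSet.of_discrete
    -- `T` is nonempty: over `T = ∅` the margin vanishes
    have hne : T.Nonempty := by
      rw [Finset.nonempty_iff_ne_empty]
      rintro rfl
      have h0 : surplus w (∅ : Finset (Fin n)) r F = fun _ => 0 := by funext u; simp [surplus]
      rw [s5dMargin, h0] at hpos
      have := slForm_zero (decoyList w (↑(∅ : Finset (Fin n)) : Set (Fin n)) D)
      simp only [cshMarg] at hpos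
      rw [show (fun _ : Fin n => (0 : ℝ)) = (0 : Fin n → ℝ) from rfl, this] at hpos
      simp at hpos
    -- the rank-maximal relay `k` and `T' = T.erase k`
    obtain ⟨k, hkT, hkmax⟩ := Finset.exists_max_image T r hne
    set T' : Finset (Fin n) := T.erase k with hT'
    have hTcard : T'.card < N := by
      have hpos' : 0 < T.card := Finset.card_pos.2 hne
      rw [hT', Finset.card_erase_of_mem hkT]; omega
    have hT'T : ∀ a ∈ T', a ∈ T := fun a ha => Finset.mem_of_mem_erase ha
    have hkT' : k ∉ T' := Finset.notMem_erase k T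
    have hlt : ∀ a ∈ T', r a < r k := by
      intro a ha
      rcases (hkmax a (hT'T a ha)).lt_or_eq with h | h
      · exact h
      · exact absurd (hr (hT'T a ha) hkT h) (Finset.ne_of_mem_erase ha)
    have hrT' : Set.InjOn r ↑T' := hr.mono (by intro a ha; exact hT'T a ha)
    have hko : o ≠ k := fun h => hoT (h ▸ hkT)
    have hkv : v ≠ k := fun h => hvT (h ▸ hkT)
    have hkK : k ∉ K := hTK k hkT
    have hkD : k ∉ D := fun h => (hDT k h).1 hkT
    -- the rank filters
    have hfk : T.filter (fun t => r t < r k) = T' := by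
      ext t
      rw [Finset.mem_filter, hT', Finset.mem_erase]
      constructor
      · rintro ⟨ht, hlt'⟩
        exact ⟨fun h => lt_irrefl _ (h ▸ hlt'), ht⟩
      · rintro ⟨htk, ht⟩
        exact ⟨ht, hlt t (Finset.mem_erase.2 ⟨htk, ht⟩)⟩
    -- the exact peeling identity and the split of the floor at `k`
    have hkey := s5dMargin_peel_top w hw T r D F o v k hkT hr hkmax
    have hsplit := floor_split_top w T r D F o v k hkT hr hkmax
    rw [← hT'] at hkey hsplit
    set Dk : Set (BondConfig (Fin n)) := {ω : BondConfig (Fin n) | ∀ a ∈ (↑T' : Set (Fin n)), ¬ (openGraph ω).Reachable k a}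
      with hDk
    set L := decoyList w (↑T : Set (Fin n)) D with hL
    set p : ℝ := obsConst w o v ((↑T : Set (Fin n)) ∪ {d | d ∈ D}) with hp
    set ck : Fin n → ℝ := avoidConst w k (↑T' : Set (Fin n)) with hck
    set Fh : Set (Sym2 (Fin n)) → ℝ := fun C => F {a | a = k ∨ ∃ e ∈ C, a ∈ e} with hFh
    have hempty_Dk : (∅ : BondConfig (Fin n)) ∈ Dk := by
      intro a ha h
      rw [HullPort.reachable_empty_iff] at h
      exact hkT' (h ▸ (Finset.mem_coe.1 ha))
    have hDkpos : 0 < μ.real Dk := prodBernoulli_real_pos_of_empty_mem w hw hempty_Dk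
    have hins : insert k (↑T' : Set (Fin n)) = ↑T := by
      rw [hT', Finset.coe_erase, insert_sdiff_singleton, insert_eq_of_mem (Finset.mem_coe.2 hkT)]
    have hnn' := fun a (ha : a ∈ T') => floor_summand_nonneg w o v T' r (k :: D) F hF hF0
      (fun a ha a' ha' hlt' => hcompat a (hT'T a ha) a' (hT'T a' ha') hlt') a ha
    have hfloor'_nn : 0 ≤ ∑ a ∈ T', (rankGain w T' r F a * avoidConst w a ((↑(T'.erase a) : Set (Fin n)) ∪ ({d | d ∈ (k :: D)} ∪ {v})) o +
        (∏ e ∈ Finset.univ.filter (fun e : Sym2 (Fin n) => ∃ y ∈ (↑(T'.filter (fun b => r b < r a)) : Set (Fin n)), y ∈ e), (1 - (w e : ℝ))) *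
          ((∫ η in ((⋃ t ∈ (insert a (T'.filter (fun b => r a < r b) ∪ ((k :: D)).toFinset)), openConn o t) ∪ openConn o v),
              F {c | c = a ∨ ∃ e ∈ openEdgeCluster η a, c ∈ e}
              ∂(prodBernoulli fun e => if (∃ y ∈ (↑(T'.filter (fun b => r b < r a)) : Set (Fin n)), y ∈ e) then (0 : unitInterval) else w e)) -
            (prodBernoulli fun e => if (∃ y ∈ (↑(T'.filter (fun b => r b < r a)) : Set (Fin n)), y ∈ e) then (0 : unitInterval) else w e).real
                ((⋃ t ∈ (insert a (T'.filter (fun b => r a < r b) ∪ ((k :: D)).toFinset)), openConn o t) ∪ openConn o v) *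
              (∫ η, F {c | c = a ∨ ∃ e ∈ openEdgeCluster η a, c ∈ e}
                ∂(prodBernoulli fun e => if (∃ y ∈ (↑(T'.filter (fun b => r b < r a)) : Set (Fin n)), y ∈ e) then (0 : unitInterval) else w e)))) :=
      Finset.sum_nonneg fun a ha => add_nonneg (hnn' a ha).1 (hnn' a ha).2
    have hnnk := floor_summand_nonneg w o v T r D F hF hF0 hcompat k hkT
    -- hypotheses for the induction on `(T', k :: D)`
    have hDT' : ∀ d ∈ k :: D, d ∉ T' ∧ d ≠ o ∧ d ≠ v := by
      intro d hd
      rcases List.mem_cons.1 hd with rfl | hd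
      · exact ⟨hkT', hko.symm, hkv.symm⟩
      · exact ⟨fun h => (hDT d hd).1 (hT'T d h), (hDT d hd).2.1, (hDT d hd).2.2⟩
    have hDK' : ∀ d ∈ k :: D, d ∉ K := by
      intro d hd
      rcases List.mem_cons.1 hd with rfl | hd
      · exact hkK
      · exact hDK d hd
    have hinv' : ∀ t ∈ T', t ∉ X → ∀ g ∈ X, g ∈ T' ∧ r g < r t := by
      intro t ht htX g hg
      obtain ⟨hgT, hglt⟩ := hinv t (hT'T t ht) htX g hg
      refine ⟨Finset.mem_erase.2 ⟨fun h => ?_, hgT⟩, hglt⟩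
      rw [h] at hglt
      exact lt_irrefl _ (lt_of_lt_of_le hglt (hkmax t (hT'T t ht)))
    -- one of the three terms of the identity is positive
    have hsum : 0 < μ.real Dk * s5dMargin w T' r (k :: D) o v F + cshMargin w k (↑T' : Set (Fin n)) D o v Fh +
        rankGain w T r F k * μ.real Dk * cshMarg L p o v ck := by
      rw [← hkey]; exact mul_pos hDkpos hpos
    rw [hsplit]
    by_cases h1 : 0 < s5dMargin w T' r (k :: D) o v F
    · -- (i) the residual margin is positive: induct
      have hih := ih T'.card hTcard T' r (k :: D) F hrT' (fun h => hoT (hT'T o h)) (fun h => hvT (hT'T v h))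
        (fun t ht => hTK t (hT'T t ht)) (List.nodup_cons.2 ⟨hkD, hD⟩) hDT' hDK' hF hF0
        (fun a ha a' ha' hlt' => hcompat a (hT'T a ha) a' (hT'T a' ha') hlt') hinv' h1 rfl
      linarith [hnnk.1, hnnk.2]
    · have h23 : 0 < cshMargin w k (↑T' : Set (Fin n)) D o v Fh + rankGain w T r F k * μ.real Dk * cshMarg L p o v ck := by
        have : μ.real Dk * s5dMargin w T' r (k :: D) o v F ≤ 0 :=
          mul_nonpos_iff.2 (Or.inl ⟨hDkpos.le, not_lt.1 h1⟩)
        linarith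
      -- the `k`-summand is positive; distinguish gate / non-gate
      suffices hk : 0 < (rankGain w T r F k * avoidConst w k ((↑(T.erase k) : Set (Fin n)) ∪ ({d | d ∈ D} ∪ {v})) o +
        (∏ e ∈ Finset.univ.filter (fun e : Sym2 (Fin n) => ∃ y ∈ (↑(T.filter (fun b => r b < r k)) : Set (Fin n)), y ∈ e), (1 - (w e : ℝ))) *
          ((∫ η in ((⋃ t ∈ (insert k (T.filter (fun b => r k < r b) ∪ (D).toFinset)), openConn o t) ∪ openConn o v),
              F {c | c = k ∨ ∃ e ∈ openEdgeCluster η k, c ∈ e}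
              ∂(prodBernoulli fun e => if (∃ y ∈ (↑(T.filter (fun b => r b < r k)) : Set (Fin n)), y ∈ e) then (0 : unitInterval) else w e)) -
            (prodBernoulli fun e => if (∃ y ∈ (↑(T.filter (fun b => r b < r k)) : Set (Fin n)), y ∈ e) then (0 : unitInterval) else w e).real
                ((⋃ t ∈ (insert k (T.filter (fun b => r k < r b) ∪ (D).toFinset)), openConn o t) ∪ openConn o v) *
              (∫ η, F {c | c = k ∨ ∃ e ∈ openEdgeCluster η k, c ∈ e}
                ∂(prodBernoulli fun e => if (∃ y ∈ (↑(T.filter (fun b => r b < r k)) : Set (Fin n)), y ∈ e) then (0 : unitInterval) else w e)))) by linarith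
      by_cases hkX : k ∈ X
      · -- GATE `k`
        obtain ⟨y, hyK, hyk⟩ := hXadj k hkX
        by_cases h3 : 0 < rankGain w T r F k * μ.real Dk * cshMarg L p o v ck
        · -- positive rank gain: `γ_k q_k > 0`
          have hγnn : 0 ≤ rankGain w T r F k := rankGain_nonneg w T r F k fun a' ha' hlt' => hcompat a' ha' k hkT hlt'
          have hγpos : 0 < rankGain w T r F k := by
            rcases hγnn.lt_or_eq with h | h
            · exact h
            · rw [← h, zero_mul, zero_mul] at h3; exact absurd h3 (lt_irrefl 0)
          have hq : 0 < avoidConst w k ((↑(T.erase k) : Set (Fin n)) ∪ ({d | d ∈ D} ∪ {v})) o := by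
            refine avoidConst_pos_of_pocket_adj w E hE0 hE1 K o hKconn k y hyK hyk hkK _ ?_ ?_
            · rintro a (ha | ha | ha)
              · exact hTK a (Finset.mem_of_mem_erase ha)
              · exact hDK a ha
              · rw [mem_singleton_iff] at ha; rw [ha]; exact hvK
            · rintro (h | h | h)
              · exact (Finset.notMem_erase k T) h
              · exact hkD h
              · exact hkv.symm (mem_singleton_iff.1 h)
          have := mul_pos hγpos hq
          linarith [hnnk.2]
        · -- positive level: the gate pair is `F`-pivotal (contrapositive of the gate locus) and pivotal for the floor's event
          have h2 : 0 < cshMargin w k (↑T' : Set (Fin n)) D o v Fh := by linarith [not_lt.1 h3]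
          have hyu : (openGraph {f | f ∈ E ∧ k ∉ f ∧ v ∉ f ∧ ∀ y' ∈ (↑T' : Set (Fin n)), y' ∉ f}).Reachable o y :=
            (hKconn y hyK).mono (BHK2006.openGraph_le fun g hg =>
              ⟨hg.1, fun h => hkK (hg.2 k h), fun h => hvK (hg.2 v h),
                fun y' hy' h => hTK y' (hT'T y' (Finset.mem_coe.1 hy')) (hg.2 y' h)⟩)
          have hpiv : ∃ η : Set (Sym2 (Fin n)), η ⊆ {f | f ∈ E ∧ ∀ y' ∈ (↑T' : Set (Fin n)), y' ∉ f} ∧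
              F (openCluster (η \ {s(k, y)}) k) < F (openCluster (insert s(k, y) η) k) := by
            by_contra hno
            push Not at hno
            have h0 := cshMargin_eq_zero_of_gate_not_pivotal w E hE0 k (↑T' : Set (Fin n)) o v
              (fun h => hkT' (Finset.mem_coe.1 h)) hko (fun h => hoT (hT'T o (Finset.mem_coe.1 h))) y hyu F hF hno D
            simp only [hFh] at h2
            rw [h0] at h2
            exact lt_irrefl _ h2
          obtain ⟨η, hηEY, hFlt⟩ := hpiv
          -- the floor's event and the pivotal configuration inside `K`
          obtain ⟨W⟩ := hKconn y hyK
          set η' : Set (Sym2 (Fin n)) := {g | g ∈ W.edges} with hη'def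
          have hWE : ∀ g ∈ η', g ∈ E ∧ ∀ z ∈ g, z ∈ K := fun g hg => (QuantBHK.mem_and_not_isDiag_of_mem_edges W hg).1
          have heη' : s(k, y) ∉ η' := fun h => hkK ((hWE _ h).2 k (Sym2.mem_mk_left k y))
          have hη'EY : η' ⊆ {f | f ∈ E ∧ ∀ y' ∈ (↑(T.filter (fun b => r b < r k)) : Set (Fin n)), y' ∉ f} := by
            intro g hg
            refine ⟨(hWE g hg).1, fun y' hy' h => hTK y' ?_ ((hWE g hg).2 y' h)⟩
            rw [hfk] at hy'
            exact hT'T y' (Finset.mem_coe.1 hy')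
          have hreachK : ∀ z, (openGraph η').Reachable o z → z ∈ K := fun z hz =>
            forall_reachable_of_edges (S := η') (fun z => z ∈ K) hoK (fun g hg z hzg => (hWE g hg).2 z hzg) hz
          have hiso := floor_iso_pos_of_pivotal w E hE0 hE1 o v T r D k F hF hF0 s(k, y) (by rw [Sym2.eq_swap]; exact hyk) ?_
            ⟨η, by rwa [hfk], ?_⟩ ⟨η', hη'EY, ?_, ?_⟩
          · linarith [hnnk.1, hiso]
          · intro y' hy' h
            rw [hfk] at hy'
            rcases Sym2.mem_iff.1 h with rfl | rfl
            · exact hkT' (Finset.mem_coe.1 hy')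
            · exact hTK y' (hT'T y' (Finset.mem_coe.1 hy')) hyK
          · rw [← KNPreFKG.openCluster_eq_setOf_openEdgeCluster, ← KNPreFKG.openCluster_eq_setOf_openEdgeCluster]
            exact hFlt
          · -- `insert e η'` joins `o` to `k`
            have hoy : (openGraph (insert s(k, y) η')).Reachable o y :=
              (QuantBHK.reachable_of_walk_edges_subset W fun g hg => hg).mono (BHK2006.openGraph_le (Set.subset_insert _ _))
            have hyk' : (openGraph (insert s(k, y) η')).Adj y k := by
              rw [openGraph, SimpleGraph.fromEdgeSet_adj]
              exact ⟨by rw [Sym2.eq_swap]; exact Set.mem_insert _ _, fun h => hkK (h ▸ hyK)⟩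
            exact Or.inl (Set.mem_iUnion₂.2 ⟨k, Finset.mem_insert_self _ _, hoy.trans hyk'.reachable⟩)
          · -- `η' ∖ e = η'` keeps `o` inside `K`, away from every target
            rw [Set.sdiff_singleton_eq_self heη']
            rintro (h | h)
            · obtain ⟨t, ht, hot⟩ := Set.mem_iUnion₂.1 h
              have htK : t ∈ K := hreachK t hot
              rcases Finset.mem_insert.1 ht with rfl | ht
              · exact hkK htK
              · rcases Finset.mem_union.1 ht with ht | ht
                · exact hTK t (Finset.mem_filter.1 ht).1 htK
                · exact hDK t (List.mem_toFinset.1 ht) htK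
            · exact hvK (hreachK v h)
      · -- NON-GATE `k`: every vertex of `X` is a relay ranked below `k`, so `X ⊆ T'`
        have hXT' : ∀ g ∈ X, g ∈ T' := by
          intro g hg
          obtain ⟨hgT, hglt⟩ := hinv k hkT hkX g hg
          exact Finset.mem_erase.2 ⟨fun h => lt_irrefl _ (h ▸ hglt), hgT⟩
        -- the rank-gain level form vanishes: all constants have the ratio `p`
        set W' : Finset (Fin n) := T ∪ D.toFinset with hW'
        have hW'set : (↑W' : Set (Fin n)) = (↑T : Set (Fin n)) ∪ {d | d ∈ D} := by ext t; simp [hW']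
        have hW'K : ∀ t ∈ W', t ∉ K := by
          intro t ht
          rcases Finset.mem_union.1 ht with ht | ht
          · exact hTK t ht
          · exact hDK t (List.mem_toFinset.1 ht)
        have hvW' : v ∉ W' := by
          intro h
          rcases Finset.mem_union.1 h with h | h
          · exact hvT h
          · exact (hDT v (List.mem_toFinset.1 h)).2.2 rfl
        set PW : Set (BondConfig (Fin n)) := {ω : BondConfig (Fin n) | ∀ t ∈ W', ¬ (openGraph ω).Reachable v t} with hPW
        have hPWeq : {ω : BondConfig (Fin n) | ∀ a ∈ (↑T : Set (Fin n)) ∪ {d | d ∈ D}, ¬ (openGraph ω).Reachable v a} = PW := by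
          ext ω; simp only [hPW, ← hW'set, Finset.mem_coe, mem_setOf_eq]
        have hPWpos : 0 < μ.real PW := by
          refine prodBernoulli_real_pos_of_empty_mem w hw (C := PW) fun t ht h => ?_
          rw [HullPort.reachable_empty_iff] at h
          exact hvW' (h ▸ ht)
        have hp' : p = μ.real (PW ∩ openConn o v) / μ.real PW := by simp only [hp, obsConst, hPWeq, hμ]
        have hratio : ∀ (A : Set (Fin n)), (↑T' : Set (Fin n)) ⊆ A → A ⊆ ↑W' → ∀ d ∈ W',
            avoidConst w d A o = p * avoidConst w d A v := by
          intro A hT'A hAW d hdW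
          by_cases hdA : d ∈ A
          · have h0 : {ω : BondConfig (Fin n) | ∀ a ∈ A, ¬ (openGraph ω).Reachable d a} = ∅ :=
              Set.eq_empty_iff_forall_notMem.2 fun ω hω => hω d hdA (SimpleGraph.Reachable.refl _)
            simp only [avoidConst, h0, empty_inter, measureReal_empty, div_zero, mul_zero]
          · have key := avoid_ratio_of_pocket w E hE0 K (↑X : Set (Fin n)) o v hoK hvK hKexit W' hW'K hvW' A
              (fun g hg => hT'A (Finset.mem_coe.2 (hXT' g (Finset.mem_coe.1 hg)))) hAW d hdW hdA
            rw [← hμ] at key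
            simp only [avoidConst]
            by_cases hden : μ.real {ω : BondConfig (Fin n) | ∀ a ∈ A, ¬ (openGraph ω).Reachable d a} = 0
            · have hnum0 : ∀ S : Set (BondConfig (Fin n)),
                  μ.real ({ω : BondConfig (Fin n) | ∀ a ∈ A, ¬ (openGraph ω).Reachable d a} ∩ S) = 0 := fun S =>
                le_antisymm (hden ▸ measureReal_mono inter_subset_left) measureReal_nonneg
              rw [hnum0, hnum0, zero_div, mul_zero]
            · rw [hp', div_mul_div_comm, div_eq_div_iff hden (mul_ne_zero hPWpos.ne' hden)]
              calc μ.real ({ω : BondConfig (Fin n) | ∀ a ∈ A, ¬ (openGraph ω).Reachable d a} ∩ openConn d o) *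
                    (μ.real PW * μ.real {ω : BondConfig (Fin n) | ∀ a ∈ A, ¬ (openGraph ω).Reachable d a})
                  = (μ.real PW * μ.real ({ω : BondConfig (Fin n) | ∀ a ∈ A, ¬ (openGraph ω).Reachable d a} ∩ openConn d o)) *
                      μ.real {ω : BondConfig (Fin n) | ∀ a ∈ A, ¬ (openGraph ω).Reachable d a} := by ring
                _ = (μ.real (PW ∩ openConn o v) *
                      μ.real ({ω : BondConfig (Fin n) | ∀ a ∈ A, ¬ (openGraph ω).Reachable d a} ∩ openConn d v)) *
                      μ.real {ω : BondConfig (Fin n) | ∀ a ∈ A, ¬ (openGraph ω).Reachable d a} := by rw [key]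
        have hck_ratio : ck o = p * ck v :=
          hratio (↑T' : Set (Fin n)) le_rfl (fun t ht => by
            rw [Finset.mem_coe, hW', Finset.mem_union]; exact Or.inl (hT'T t (Finset.mem_coe.1 ht))) k
            (by rw [hW', Finset.mem_union]; exact Or.inl hkT)
        have hL_ratio : ∀ dc ∈ L, dc.2 o = p * dc.2 v := by
          refine decoyList_forall w (fun c => c o = p * c v) (↑T : Set (Fin n)) D ?_
          intro A' hA' hA'' d hd
          refine hratio A'
            ((show (↑T' : Set (Fin n)) ⊆ ↑T from fun t ht => Finset.mem_coe.2 (hT'T t (Finset.mem_coe.1 ht))).trans hA')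
            (fun t ht => ?_) d ?_
          · rw [Finset.mem_coe, hW', Finset.mem_union, List.mem_toFinset]
            rcases hA'' ht with h | h
            · exact Or.inl (Finset.mem_coe.1 h)
            · exact Or.inr h
          · rw [hW', Finset.mem_union, List.mem_toFinset]; exact Or.inr hd
        have hM0 : cshMarg L p o v ck = 0 := cshMarg_eq_zero_of_ratio L p o v hL_ratio ck hck_ratio
        have h2 : 0 < cshMargin w k (↑T' : Set (Fin n)) D o v Fh := by
          rw [hM0, mul_zero, add_zero] at h23; exact h23
        -- decoy invisibility: the level is its decoy-free level
        have hinvis : cshMargin w k (↑T' : Set (Fin n)) D o v Fh = cshMargin w k (↑T' : Set (Fin n)) [] o v Fh := by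
          refine cshMargin_eq_nil_of_decoys_off_pocket w hw E hE0 k (↑T' : Set (Fin n)) o v K hoK hvK ?_ ?_ ?_ D hDK
            (fun d hd => (hDT d hd).2.2) Fh
          · intro a ha haK
            rw [hins] at ha
            exact hTK a (Finset.mem_coe.1 ha) haK
          · rw [hins]; exact fun h => hvT (Finset.mem_coe.1 h)
          · intro p' q hpq hp'
            rcases hKexit p' q hpq hp' with h | h | h
            · exact Or.inl h
            · exact Or.inr (Or.inl h)
            · refine Or.inr (Or.inr ?_)
              rw [hins]
              exact Finset.mem_coe.2 (hT'T q (hXT' q (Finset.mem_coe.1 h)))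
        rw [hinvis] at h2
        -- the decoy-free locus: a common pivotal pair for `F(V 𝒞_k)` and `{o ↔ k} ∪ {o ↔ v}`
        have hkY : k ∉ (↑T' : Set (Fin n)) := fun h => hkT' (Finset.mem_coe.1 h)
        have hoY : o ∉ (↑T' : Set (Fin n)) := fun h => hoT (hT'T o (Finset.mem_coe.1 h))
        have hvY : v ∉ (↑T' : Set (Fin n)) := fun h => hvT (hT'T v (Finset.mem_coe.1 h))
        obtain ⟨e, heE, heY, ⟨η, hηEY, hFlt⟩, ⟨η', hη'EY, hU1, hU0⟩⟩ :=
          (cshMargin_nil_pos_iff_exists_pivotal_vertexFun w E hE0 hE1 k (↑T' : Set (Fin n)) o v hkY hko hkv hoY hvY hov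
            F hF hF0).1 h2
        have hiso := floor_iso_pos_of_pivotal w E hE0 hE1 o v T r D k F hF hF0 e heE (by rwa [hfk]) ⟨η, by rwa [hfk], hFlt⟩
            ⟨η', by rwa [hfk], ?_, ?_⟩
        · linarith [hnnk.1, hiso]
        · rcases hU1 with h | h
          · exact Or.inl (Set.mem_iUnion₂.2 ⟨k, Finset.mem_insert_self _ _, h⟩)
          · exact Or.inr h
        · intro hmem
          have hωE : η' \ {e} ⊆ E := fun g hg => (hη'EY hg.1).1
          have hωY : ∀ g ∈ η' \ {e}, ∀ y' ∈ (↑T' : Set (Fin n)), y' ∉ g := fun g hg => (hη'EY hg.1).2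
          rcases hmem with h | h
          · obtain ⟨t, ht, hot⟩ := Set.mem_iUnion₂.1 h
            rcases Finset.mem_insert.1 ht with rfl | ht
            · exact hU0 (Or.inl hot)
            · have htK : t ∉ K := by
                rcases Finset.mem_union.1 ht with ht | ht
                · exact hTK t (Finset.mem_filter.1 ht).1
                · exact hDK t (List.mem_toFinset.1 ht)
              obtain ⟨W⟩ := hot
              obtain ⟨p', q, hp', hq, hpq, hreach⟩ := exists_exit_of_walk_set hωE hKexit W hoK htK
              rcases hq with hq | hq
              · rw [hq] at hreach
                exact hU0 (Or.inr hreach)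
              · -- a pair into a gate meets `T'`: impossible inside `E − pairs(T')`
                exact hωY _ hpq q (Finset.mem_coe.2 (hXT' q (Finset.mem_coe.1 hq))) (Sym2.mem_mk_right _ _)
          · exact hU0 (Or.inr h)

end CSH

end Summit.CriticalPhenomena.PercolationContinuityZ3.Theorems

end
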